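import Summits.BirchSwinnertonDyer.BirchSwinnertonDyer.Theorems.PrintCf2RamifiedOffTYZQFormForestCofactors
import Literature.LinearAlgebra.Matrix.BipartiteForestSecondCofactor
import HarnessLib

/-!
# Route `PrintCf2`, crux stmt-BirchSwinnertonDyer-20509 `RamifiedOffTYZOfFacts` — the Q-form identity (★): THE PINNED EXPANSION (F2)
# (cell `bsd-print-cf2`, LEAD of 20509 g6, line `offtyz-v7`, cycle 7; kernel helpers `--supports stmt-BirchSwinnertonDyer-20509`)

Third file of the kernel proof of g5's conjecture (★) `Q_n = q(κ_n)` (crux workfile `Cruxes/RamifiedOffTYZOfFacts/Lines/offtyz_v7_QFormProof.md`,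
(R5) and (5c)). Abstract arc weights `a : V → V → 𝔽₂` under the reciprocity law `a s t + a t s = y s * y t`; `N_X = lap a X y`.

* `indicator_vecMul_lap_root_eq_zero`, `adjugate_lap_root_eq_of_even` — on an even block (`Σ_X y = 0`) the indicator of `X` kills the columns of
  `N_X`, so the rows of `adj(N_X)` are constant (note (R5)).
* `det_unitize_unitize_bigN_zero_zero` — the second cofactor of the unmarked, unrooted doubled matrix `bigN a X 0 0 ℓ` at a mark copy `inl u` and
  a root copy `inr s₀` is the first cofactor `adj(lap a X ℓ)_{u s₀}` (row permutation to `[[L, 0],[0, Lᵀ]]` and exchange of the two unit rows).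
* `adjugate_bigN_single_zero_inr_inr` — hence the root-copy cofactor of `bigN a X e_u 0 ℓ` is `adj(lap a X ℓ)_{u s₀}` (slope in the mark).
* `pinned_expansion_eq` — **the pinned all-minors expansion, evaluated** (note (5c)): for `Σ_X y = 0`, `s₀ ∈ X` and every `x`,
  `Σ_{s₀ ∈ T ⊆ X} (Σ_T x) κ_{s₀}(T) setExp(q_y)(X∖T) = q_x(X) + (Σ_X x) q_y(X)` — the tree's rooted pointed forest sum `adjugate_bigN_inr_inr`
  read with marks `x`, no roots and extra roots `y`, evaluated through the three previous items and `adjugate_lap_self_eq`.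
Pure linear algebra over `𝔽₂`; no `sorry`. BSD is not proved by any of this; no class is closed.

References: [cite: Chaiken1982, §2 (all minors matrix tree theorem)]; [cite: Smith2016CongruentDensity, §2.1–§2.2];
[cite: HeathBrown1994SelmerCongruentII, Appendix (Monsky), typescript p. 39 L36–L41 (law (31))].
-/

namespace Summit.BirchSwinnertonDyer.PrintCf2.QFormForest

open Matrix Finset Literature.LinearAlgebra.Matrix Literature.Combinatorics.Enumerative
open Literature.NumberTheory.EllipticCurves.Smith2016

variable {V : Type*} [Fintype V] [LinearOrder V]



/-- **Column sums of an even block with root weights `y` vanish**: under the reciprocity law on `X` with `Σ_X y = 0`, the indicator of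
`X` is a left null vector of `N_X = lap a X y` (column `j`: `y_j + Σ_{r≠j}(a j r + a r j) = y_j + y_j Σ_{r ≠ j} y_r = y_j + y_j² = 0`).
[cite: HeathBrown1994SelmerCongruentII, Appendix (Monsky), typescript p. 39 L36–L41 (law (31))] -/
theorem indicator_vecMul_lap_root_eq_zero (a : V → V → ZMod 2) (y : V → ZMod 2) {X : Finset V}
    (hrec : ∀ i ∈ X, ∀ j ∈ X, i ≠ j → a i j + a j i = y i * y j) (hyX : ∑ i ∈ X, y i = 0) :
    (fun r => if r ∈ X then (1 : ZMod 2) else 0) ᵥ* lap a X y = 0 := by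
  ext j
  rw [Pi.zero_apply, vecMul, dotProduct]
  simp only [ite_mul, one_mul, zero_mul]
  rw [← sum_filter, filter_mem_eq_inter, univ_inter]
  by_cases hj : j ∈ X
  · have hcol : ∀ r ∈ X.erase j, lap a X y r j = a r j := fun r hr => by
      rw [lap_apply, if_pos (And.intro (mem_of_mem_erase hr) hj), if_neg (ne_of_mem_erase hr)]
    rw [← add_sum_erase X _ hj, lap_apply, if_pos (And.intro hj hj), if_pos rfl, sum_congr rfl hcol, add_assoc,
      ← sum_add_distrib]
    have hpair : ∀ r ∈ X.erase j, (a j r + a r j) = y j * y r := fun r hr =>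
      hrec j hj r (mem_of_mem_erase hr) (ne_of_mem_erase hr).symm
    rw [sum_congr rfl hpair, ← mul_sum]
    have hy : ∑ r ∈ X.erase j, y r = y j := by
      have h := add_sum_erase X y hj
      rw [hyX] at h
      have h2 : ∀ u v : ZMod 2, u + v = 0 → v = u := by decide
      exact h2 _ _ h
    rw [hy]
    have h3 : ∀ u : ZMod 2, u + u * u = 0 := by decide
    exact h3 _
  · refine sum_eq_zero fun r hr => ?_
    have hrj : r ≠ j := fun h => hj (h ▸ hr)
    rw [lap_apply, if_neg (fun h => hj h.2), if_neg hrj]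

/-- **The rows of `adj(N_X)` are constant on an even block** (note (R5)): for `Σ_X y = 0` and `u, s, s' ∈ X`,
`adj(lap a X y)_{u s} = adj(lap a X y)_{u s'}` (the indicator of `X` kills the columns of `N_X`).
[cite: Smith2016CongruentDensity, §2.1 (chunk p0006 L58–L66: all cofactors along a line of a zero-sum matrix agree)] -/
theorem adjugate_lap_root_eq_of_even (a : V → V → ZMod 2) (y : V → ZMod 2) {X : Finset V}
    (hrec : ∀ i ∈ X, ∀ j ∈ X, i ≠ j → a i j + a j i = y i * y j) (hyX : ∑ i ∈ X, y i = 0)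
    {u s s' : V} (hs : s ∈ X) (hs' : s' ∈ X) :
    (lap a X y).adjugate u s = (lap a X y).adjugate u s' := by
  rw [adjugate_apply, adjugate_apply, ← det_updateCol_single_eq_det_updateRow_single,
    ← det_updateCol_single_eq_det_updateRow_single]
  have hdec : (Pi.single s (1 : ZMod 2) : V → ZMod 2) = Pi.single s' 1 + (Pi.single s 1 - Pi.single s' 1) := by abel
  rw [hdec, det_updateCol_add]
  suffices h0 : ((lap a X y).updateCol u (Pi.single s 1 - Pi.single s' 1)).det = 0 by rw [h0, add_zero]
  refine Matrix.exists_vecMul_eq_zero_iff.mp ⟨fun r => if r ∈ X then (1 : ZMod 2) else 0, ?_, ?_⟩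
  · intro h
    have := congrFun h s
    simp [hs] at this
  · ext j
    rw [Pi.zero_apply, vecMul, dotProduct]
    by_cases hju : j = u
    · subst hju
      simp only [updateCol_self, Pi.sub_apply, Pi.single_apply, ite_mul, one_mul, zero_mul]
      rw [← sum_filter, filter_mem_eq_inter, univ_inter]
      rw [sum_sub_distrib, sum_ite_eq' X s, sum_ite_eq' X s', if_pos hs, if_pos hs', sub_self]
    · have h := congrFun (indicator_vecMul_lap_root_eq_zero a y hrec hyX) j
      rw [Pi.zero_apply, vecMul, dotProduct] at h
      refine Eq.trans (sum_congr rfl fun r _ => ?_) h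
      rw [updateCol_ne hju]

/-- **The second cofactor of the unmarked, unrooted doubled matrix is a first cofactor of the Laplacian block**: for `u, s₀ ∈ X`,
`det (unitize (unitize (bigN a X 0 0 ℓ) (inl u)) (inr s₀)) = adj(lap a X ℓ)_{u s₀}` — at `y = z = 0` the doubled matrix is, up to the
row permutation exchanging the two copies of `X`, block diagonal `[[L, 0],[0, Lᵀ]]`; deleting the mark copy of `u` and the root copy of
`s₀` and exchanging the two unit rows gives `[[L with row s₀ ← e_u, 0],[0, Lᵀ with row u ← e_{s₀}]]`, of determinant `adj(L)_{u s₀}²`.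
[cite: Chaiken1982, §2 (all minors matrix tree theorem: one vertex of U and one of W deleted)] -/
theorem det_unitize_unitize_bigN_zero_zero (a : V → V → ZMod 2) {X : Finset V} (ℓ : V → ZMod 2) {u s₀ : V}
    (hu : u ∈ X) (hs₀ : s₀ ∈ X) :
    (unitize (unitize (bigN a X 0 0 ℓ) (Sum.inl u)) (Sum.inr s₀)).det = (lap a X ℓ).adjugate u s₀ := by
  have hne : (Sum.inl u : V ⊕ V) ≠ Sum.inr s₀ := Sum.inl_ne_inr
  rw [det_unitize_unitize _ hne]
  set N := bigN a X 0 0 ℓ with hN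
  set L := lap a X ℓ with hL
  set M₂ := (N.updateRow (Sum.inl u) (Pi.single (Sum.inl u) 1)).updateRow (Sum.inr s₀)
    (Pi.single (Sum.inr s₀) 1) with hM₂
  set τ : Equiv.Perm (V ⊕ V) := (Equiv.swap (Sum.inl s₀) (Sum.inr u)).trans (swapCopies X) with hτ
  have hFB := bigN_zero_zero_submatrix a X ℓ
  -- rows of `M₂` seen through `τ`
  have hrow_u : M₂ (Sum.inl u) = Pi.single (Sum.inl u) 1 := by
    rw [hM₂, updateRow_ne hne, updateRow_self]
  have hrow_s : M₂ (Sum.inr s₀) = Pi.single (Sum.inr s₀) 1 := by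
    rw [hM₂, updateRow_self]
  have hrow_other : ∀ r, r ≠ Sum.inl u → r ≠ Sum.inr s₀ → M₂ r = N r := by
    intro r h1 h2
    rw [hM₂, updateRow_ne h2, updateRow_ne h1]
  have hσu : swapCopies X (Sum.inr u) = Sum.inl u := by simp [swapCopies, hu]
  have hσs : swapCopies X (Sum.inl s₀) = Sum.inr s₀ := by simp [swapCopies, hs₀]
  have hτs : τ (Sum.inl s₀) = Sum.inl u := by
    rw [hτ, Equiv.trans_apply, Equiv.swap_apply_left, hσu]
  have hτu : τ (Sum.inr u) = Sum.inr s₀ := by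
    rw [hτ, Equiv.trans_apply, Equiv.swap_apply_right, hσs]
  have hτo : ∀ r, r ≠ Sum.inl s₀ → r ≠ Sum.inr u → τ r = swapCopies X r := by
    intro r h1 h2
    rw [hτ, Equiv.trans_apply, Equiv.swap_apply_of_ne_of_ne h1 h2]
  have hσo1 : ∀ r, r ≠ Sum.inr u → swapCopies X r ≠ Sum.inl u := by
    intro r h hc
    exact h ((swapCopies X).injective (hc.trans hσu.symm))
  have hσo2 : ∀ r, r ≠ Sum.inl s₀ → swapCopies X r ≠ Sum.inr s₀ := by
    intro r h hc
    exact h ((swapCopies X).injective (hc.trans hσs.symm))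
  have key : M₂.submatrix τ id =
      fromBlocks (L.updateRow s₀ (Pi.single u 1)) 0 0 (Lᵀ.updateRow u (Pi.single s₀ 1)) := by
    ext r c
    rw [submatrix_apply, id]
    by_cases hrs : r = Sum.inl s₀
    · subst hrs
      rw [hτs, hrow_u]
      rcases c with k | k
      · rw [fromBlocks_apply₁₁, updateRow_self]
        by_cases huk : u = k
        · subst huk; simp
        · rw [Pi.single_eq_of_ne (fun h => huk (Sum.inl_injective h).symm), Pi.single_eq_of_ne (Ne.symm huk)]
      · rw [fromBlocks_apply₁₂, Matrix.zero_apply, Pi.single_eq_of_ne Sum.inr_ne_inl]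
    by_cases hru : r = Sum.inr u
    · subst hru
      rw [hτu, hrow_s]
      rcases c with k | k
      · rw [fromBlocks_apply₂₁, Matrix.zero_apply, Pi.single_eq_of_ne Sum.inl_ne_inr]
      · rw [fromBlocks_apply₂₂, updateRow_self]
        by_cases hsk : s₀ = k
        · subst hsk; simp
        · rw [Pi.single_eq_of_ne (fun h => hsk (Sum.inr_injective h).symm), Pi.single_eq_of_ne (Ne.symm hsk)]
    -- all other rows are rows of `N` permuted by `swapCopies`, i.e. rows of `[[L, 0], [0, Lᵀ]]`
    rw [hτo r hrs hru, hrow_other _ (hσo1 r hru) (hσo2 r hrs)]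
    have hfb := congrFun (congrFun hFB r) c
    rw [submatrix_apply, id] at hfb
    rw [hN, hfb]
    rcases r with i | i
    · have his : i ≠ s₀ := fun h => hrs (by rw [h])
      rcases c with k | k
      · rw [fromBlocks_apply₁₁, fromBlocks_apply₁₁, updateRow_ne his]
      · rw [fromBlocks_apply₁₂, fromBlocks_apply₁₂]
    · have hiu : i ≠ u := fun h => hru (by rw [h])
      rcases c with k | k
      · rw [fromBlocks_apply₂₁, fromBlocks_apply₂₁]
      · rw [fromBlocks_apply₂₂, fromBlocks_apply₂₂, updateRow_ne hiu]
  have hdet := det_permute τ M₂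
  rw [key, det_fromBlocks_zero₂₁, ← adjugate_apply, ← adjugate_apply, ← adjugate_transpose, transpose_apply,
    Literature.LinearAlgebra.QuadraticForm.zmod_two_mul_self] at hdet
  have hsign : ((Equiv.Perm.sign τ : ℤ) : ZMod 2) = 1 := by
    rcases Int.units_eq_one_or (Equiv.Perm.sign τ) with h1 | h1 <;> rw [h1] <;> decide
  rw [hsign, one_mul] at hdet
  rw [hM₂] at hdet
  exact hdet.symm



/-- With zero root weights the block weight of the doubled matrix is the `ℓ`-forest weight: `fwt a m 0 ℓ = q_ℓ` (the marks are idle).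
[cite: Chaiken1982, §2 (all minors matrix tree theorem)] -/
theorem fwt_zero_root (a : V → V → ZMod 2) (m ℓ : V → ZMod 2) : fwt a m 0 ℓ = qwt a ℓ := by
  funext B
  rw [fwt, qwt_zero_weight]
  simp

/-- **The root-copy cofactor of the doubled matrix with a single mark and no roots is a first cofactor of the Laplacian block**:
for `u, s₀ ∈ X`, `adj(bigN a X e_u 0 ℓ)_{(inr s₀)(inr s₀)} = adj(lap a X ℓ)_{u s₀}` (slope of the cofactor in the mark at `u` =
second cofactor, evaluated by `det_unitize_unitize_bigN_zero_zero`; the cofactor at zero marks vanishes).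
[cite: Chaiken1982, §2 (all minors matrix tree theorem)] -/
theorem adjugate_bigN_single_zero_inr_inr (a : V → V → ZMod 2) {X : Finset V} (ℓ : V → ZMod 2) {u s₀ : V}
    (hu : u ∈ X) (hs₀ : s₀ ∈ X) :
    (bigN a X (Pi.single u 1) 0 ℓ).adjugate (Sum.inr s₀) (Sum.inr s₀) = (lap a X ℓ).adjugate u s₀ := by
  have hne : (Sum.inl u : V ⊕ V) ≠ Sum.inr s₀ := Sum.inl_ne_inr
  have hsingle : (Pi.single u (1 : ZMod 2) : V → ZMod 2) = Function.update (0 : V → ZMod 2) u ((0 : V → ZMod 2) u + 1) := by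
    rw [Pi.zero_apply, zero_add]; rfl
  rw [hsingle, bigN_update_mark a hu 0 0 ℓ 1, adjugate_updateRow_add_single _ hne, one_mul,
    det_unitize_unitize_bigN_zero_zero a ℓ hu hs₀, adjugate_bigN_inr_inr a hs₀]
  simp

/-- **The pinned all-minors expansion, evaluated** (note (5c)): under the reciprocity law on `X` with `Σ_X y = 0`, for `s₀ ∈ X` and every
root-weight vector `x`, `Σ_{s₀ ∈ T ⊆ X} (Σ_T x) · κ_{s₀}(T) · setExp(q_y)(X∖T) = q_x(X) + (Σ_X x) · q_y(X)`. The left side is linear in `x`;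
at `x = e_u` it is the root-copy cofactor `adj(bigN a X e_u 0 y)_{(inr s₀)(inr s₀)}` (`adjugate_bigN_inr_inr`) `= adj(N_X)_{u s₀}`
(`adjugate_bigN_single_zero_inr_inr`) `= adj(N_X)_{u u}` (even block: `adjugate_lap_root_eq_of_even`) `= κ_u(X) + q_y(X)` (`adjugate_lap_self_eq`).
In particular for `Σ_X x = 0` the pinned sum IS `q_x(X)`. [cite: Chaiken1982, §2] [cite: Smith2016CongruentDensity, §2.2 case 5(b)] -/
theorem pinned_expansion_eq (a : V → V → ZMod 2) (y x : V → ZMod 2) {X : Finset V}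
    (hrec : ∀ i ∈ X, ∀ j ∈ X, i ≠ j → a i j + a j i = y i * y j) (hyX : ∑ i ∈ X, y i = 0) {s₀ : V} (hs₀ : s₀ ∈ X) :
    ∑ E ∈ (X.erase s₀).powerset, (∑ i ∈ insert s₀ E, x i) * treeDet a (insert s₀ E) s₀ * setExp (qwt a y) (X.erase s₀ \ E) =
      qwt a x X + (∑ i ∈ X, x i) * qwt a y X := by
  -- the value at a unit vector `e_u`, `u ∈ X`
  have hunit : ∀ u ∈ X, ∑ E ∈ (X.erase s₀).powerset,
      (∑ i ∈ insert s₀ E, (Pi.single u (1 : ZMod 2) : V → ZMod 2) i) * treeDet a (insert s₀ E) s₀ * setExp (qwt a y) (X.erase s₀ \ E) =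
        treeDet a X u + qwt a y X := by
    intro u hu
    have h := adjugate_bigN_inr_inr a hs₀ (Pi.single u (1 : ZMod 2)) 0 y
    rw [fwt_zero_root] at h
    rw [← h, adjugate_bigN_single_zero_inr_inr a y hu hs₀, adjugate_lap_root_eq_of_even a y hrec hyX hs₀ hu,
      adjugate_lap_self_eq a y hrec hyX hu]
  -- linearity in `x`: expand `Σ_{i ∈ B} x i = Σ_{u ∈ X} x u · [u ∈ B]` for `B ⊆ X`
  have hlin : ∀ E ∈ (X.erase s₀).powerset,
      (∑ i ∈ insert s₀ E, x i) = ∑ u ∈ X, x u * ∑ i ∈ insert s₀ E, (Pi.single u (1 : ZMod 2) : V → ZMod 2) i := by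
    intro E hE
    rw [mem_powerset] at hE
    have hBX : insert s₀ E ⊆ X := insert_subset hs₀ (hE.trans (erase_subset s₀ X))
    have h : ∀ u ∈ X, x u * ∑ i ∈ insert s₀ E, (Pi.single u (1 : ZMod 2) : V → ZMod 2) i =
        if u ∈ insert s₀ E then x u else 0 := by
      intro u _
      rw [sum_pi_single']
      split_ifs <;> simp
    rw [sum_congr rfl h, ← sum_filter, filter_mem_eq_inter, inter_eq_right.mpr hBX]
  have hstep : ∀ E ∈ (X.erase s₀).powerset,
      (∑ i ∈ insert s₀ E, x i) * treeDet a (insert s₀ E) s₀ * setExp (qwt a y) (X.erase s₀ \ E) =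
        ∑ u ∈ X, x u * ((∑ i ∈ insert s₀ E, (Pi.single u (1 : ZMod 2) : V → ZMod 2) i) * treeDet a (insert s₀ E) s₀ *
          setExp (qwt a y) (X.erase s₀ \ E)) := by
    intro E hE
    rw [hlin E hE, sum_mul, sum_mul]
    exact sum_congr rfl fun u _ => by ring
  rw [sum_congr rfl hstep, sum_comm]
  have hu : ∀ u ∈ X, ∑ E ∈ (X.erase s₀).powerset,
      x u * ((∑ i ∈ insert s₀ E, (Pi.single u (1 : ZMod 2) : V → ZMod 2) i) * treeDet a (insert s₀ E) s₀ *
        setExp (qwt a y) (X.erase s₀ \ E)) = x u * treeDet a X u + x u * qwt a y X := by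
    intro u huX
    rw [← mul_sum, hunit u huX, mul_add]
  rw [sum_congr rfl hu, sum_add_distrib, ← sum_mul]
  rfl



end Summit.BirchSwinnertonDyer.PrintCf2.QFormForest
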